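import Mathlib

/-!
# SoloBlind — the walk-reversal parity lemma (the engine of THEOREM H, the hafnian rule)

Part of the solo-blind programme on the Kontsevich–Zagier conjecture (`paper/hafnian-theorem.md`, s33).
THEOREM H there computes the support signature `S ↦ f_S(a_I)` of every Anderson–Das torsion class `a_I`
of the universal odd distribution (`I` an even set of odd primes) as the hafnian, over `𝔽₂`, of the
`S`-symmetrised Legendre matrix of `I`.  After the homological reduction (rule independence of Das's
canonical lifting) and the choice of discrete-logarithm half-systems, the transfer operator of a prime `u`
acting in the phase of a supported prime `p` is `I + N^λ`, `N^λ` the shift of `𝔽₂^h` (`h = (p-1)/2`) by the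
signed index `λ = λ(u)`, truncated to the strip `[0,h)`.  A product of truncated shifts counts the starting
points `i < h` from which the walk with the given steps stays inside `[0,h)`; the whole cancellation
"two or more unsupported primes in one phase contribute `0 mod 2`" (LEMMA Φ(3) of the paper) rests on the
statement certified here:

* `walkCount_reverse` : the number of confined starting points is unchanged when the list of steps is
  reversed (the bijection `i ↦ h - 1 - Σν - i`);
* `even_sum_perm_walkCount` : consequently, for `r ≥ 2` steps `ν : Fin r → ℤ`, the symmetrised count
  `∑_{σ ∈ S_r} walkCount h (ν ∘ σ)` is EVEN — reversal `σ ↦ rev ∘ σ` is a fixed-point-free involution on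
  the orderings preserving each summand.

Both statements are elementary and general (any `h`, any integer steps); they are the only point in the
proof of THEOREM H where a parity miracle happens, everything else being bookkeeping modulo 2.
-/

namespace Summit.KontsevichZagierPeriods.KontsevichZagierPeriods.Theorems
namespace SoloBlind
namespace StripWalk

open Finset

/-- The set of starting points `i < h` from which the walk `i, i + ν₀, i + ν₀ + ν₁, …` never leaves `[0, h)`. -/
noncomputable def confined (h : ℕ) (ν : List ℤ) : Finset ℕ := by
  classical
  exact (Finset.range h).filter fun i =>
    ∀ j ∈ Finset.range (ν.length + 1), (0 : ℤ) ≤ i + (ν.take j).sum ∧ (i : ℤ) + (ν.take j).sum < h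

/-- Number of confined starting points ( = `1ᵀ N^{ν_{r-1}} ⋯ N^{ν_0} 1` for the truncated shifts). -/
noncomputable def walkCount (h : ℕ) (ν : List ℤ) : ℕ := (confined h ν).card

/-- Membership in `confined`: `i < h` and every partial sum `i + ν₀ + ⋯ + ν_{j-1}` lies in `[0, h)`. -/
theorem mem_confined (h : ℕ) (ν : List ℤ) (i : ℕ) :
    i ∈ confined h ν ↔ i < h ∧ ∀ j ≤ ν.length, (0 : ℤ) ≤ i + (ν.take j).sum ∧ (i : ℤ) + (ν.take j).sum < h := by
  classical
  unfold confined
  simp [Finset.mem_filter, Finset.mem_range]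

/-- Partial sums of the reversed list: `Σ_{k<j} ν.reverse_k = Σν - Σ_{k < |ν|-j} ν_k`. -/
theorem sum_take_reverse (ν : List ℤ) (j : ℕ) :
    (ν.reverse.take j).sum = ν.sum - (ν.take (ν.length - j)).sum := by
  rw [List.take_reverse, List.sum_reverse]
  have := List.sum_take_add_sum_drop ν (ν.length - j)
  linarith

/-- Reversing the steps does not change the number of confined starting points. -/
theorem walkCount_reverse (h : ℕ) (ν : List ℤ) : walkCount h ν.reverse = walkCount h ν := by
  classical
  unfold walkCount
  -- the bijection i ↦ h - 1 - Σν - i (in both directions)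
  have key : ∀ (μ : List ℤ) (i : ℕ), i ∈ confined h μ.reverse →
      Int.toNat ((h : ℤ) - 1 - μ.sum - i) ∈ confined h μ ∧
      (Int.toNat ((h : ℤ) - 1 - μ.sum - i) : ℤ) = (h : ℤ) - 1 - μ.sum - i := by
    intro μ i hi
    rw [mem_confined] at hi
    obtain ⟨hih, hall⟩ := hi
    have hlen : μ.reverse.length = μ.length := List.length_reverse
    -- the condition at j = length gives 0 ≤ i + Σμ < h
    have htop := hall μ.reverse.length le_rfl
    rw [List.take_length, List.sum_reverse] at htop
    have hnn : (0 : ℤ) ≤ (h : ℤ) - 1 - μ.sum - i := by omega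
    have hcast : (Int.toNat ((h : ℤ) - 1 - μ.sum - i) : ℤ) = (h : ℤ) - 1 - μ.sum - i := Int.toNat_of_nonneg hnn
    refine ⟨?_, hcast⟩
    rw [mem_confined]
    refine ⟨?_, ?_⟩
    · have : ((Int.toNat ((h : ℤ) - 1 - μ.sum - i) : ℕ) : ℤ) < h := by rw [hcast]; omega
      exact_mod_cast this
    · intro j hj
      have hj' : μ.length - j ≤ μ.reverse.length := by rw [hlen]; omega
      have hcond := hall (μ.length - j) hj'
      rw [sum_take_reverse, show μ.length - (μ.length - j) = j by omega] at hcond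
      rw [hcast]
      constructor <;> omega
  refine Finset.card_bij' (fun (i : ℕ) _ => (Int.toNat ((h : ℤ) - 1 - ν.sum - (i : ℤ)) : ℕ))
      (fun (i : ℕ) _ => (Int.toNat ((h : ℤ) - 1 - ν.sum - (i : ℤ)) : ℕ)) ?_ ?_ ?_ ?_
  · intro i hi
    exact (key ν i hi).1
  · intro i hi
    have hi' : i ∈ confined h ν.reverse.reverse := by rwa [List.reverse_reverse]
    have := (key ν.reverse i hi').1
    rwa [List.sum_reverse] at this
  · intro i hi
    have hc := (key ν i hi).2
    omega
  · intro i hi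
    have hi' : i ∈ confined h ν.reverse.reverse := by rwa [List.reverse_reverse]
    have hc := (key ν.reverse i hi').2
    rw [List.sum_reverse] at hc
    omega

/-- `List.ofFn (f ∘ Fin.rev)` is the reverse of `List.ofFn f`. -/
theorem ofFn_comp_rev {α : Type*} {r : ℕ} (f : Fin r → α) :
    List.ofFn (fun i => f (Fin.rev i)) = (List.ofFn f).reverse := by
  apply List.ext_getElem
  · simp
  · intro n h1 h2
    simp only [List.getElem_ofFn, List.getElem_reverse, List.length_ofFn]
    congr 1
    ext
    simp [Fin.rev]
    rw [List.length_ofFn] at h1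
    omega

/-- For `r ≥ 2` steps, the count symmetrised over all orderings of the steps is even. -/
theorem even_sum_perm_walkCount (h : ℕ) {r : ℕ} (hr : 2 ≤ r) (ν : Fin r → ℤ) :
    Even (∑ σ : Equiv.Perm (Fin r), walkCount h (List.ofFn (ν ∘ ⇑σ))) := by
  classical
  have key : ∀ σ : Equiv.Perm (Fin r),
      walkCount h (List.ofFn (ν ∘ ⇑(Fin.revPerm.trans σ))) = walkCount h (List.ofFn (ν ∘ ⇑σ)) := by
    intro σ
    have : List.ofFn (ν ∘ ⇑(Fin.revPerm.trans σ)) = (List.ofFn (ν ∘ ⇑σ)).reverse := by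
      rw [← ofFn_comp_rev]
      congr 1
    rw [this, walkCount_reverse]
  have hz : (∑ σ : Equiv.Perm (Fin r), (walkCount h (List.ofFn (ν ∘ ⇑σ)) : ZMod 2)) = 0 := by
    refine Finset.sum_involution (fun σ _ => Fin.revPerm.trans σ) ?_ ?_ ?_ ?_
    · intro σ _
      rw [key]
      generalize (walkCount h (List.ofFn (ν ∘ ⇑σ)) : ZMod 2) = x
      have h2 : (2 : ZMod 2) = 0 := by decide
      calc x + x = 2 * x := by ring
        _ = 0 := by rw [h2, zero_mul]
    · intro σ _ _ hEq
      have h2 : (Fin.revPerm : Equiv.Perm (Fin r)) = Equiv.refl _ := by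
        have := congrArg (fun e => e.trans σ.symm) hEq
        simpa [Equiv.trans_assoc] using this
      have h3 := congrArg (fun e => ((e ⟨0, by omega⟩ : Fin r) : ℕ)) h2
      simp [Fin.revPerm_apply, Fin.rev] at h3
      omega
    · intro σ _
      exact Finset.mem_univ _
    · intro σ _
      ext x
      simp [Equiv.trans_apply, Fin.revPerm_apply, Fin.rev_rev]
  have hn : ((∑ σ : Equiv.Perm (Fin r), walkCount h (List.ofFn (ν ∘ ⇑σ)) : ℕ) : ZMod 2) = 0 := by
    push_cast
    exact hz
  rw [ZMod.natCast_eq_zero_iff] at hn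
  exact even_iff_two_dvd.mpr hn

end StripWalk
end SoloBlind
end Summit.KontsevichZagierPeriods.KontsevichZagierPeriods.Theorems
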